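import Literature.MathematicalPhysics.QuantumFieldTheory.Balaban1983to89.Beta.RemainderHasMajH1kTower
import Literature.MathematicalPhysics.QuantumFieldTheory.Balaban1983to89.Beta.RemainderOriginLeftEntry

/-!
# T. Bałaban, *The variational problem and background fields in renormalization group method for lattice gauge theories*, Commun. Math.
# Phys. **102** (1985) 277–309 [Balaban1985Variational] (182) p. 307, (190) p. 308, (129) p. 297 (*«(3.133) [5] with the additional inequality for the
# covariant Laplace operator»*), with [Balaban1985BackgroundPropagators] Thm 3.3 (3.42) pp. 397–399 (the covariant-derivative line), (3.8) p. 392: **THE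
# DIVERGENCE LINE OF NODE D OF ROW (D4) AT THE ORIGIN IN A BACKGROUND ON NE9's TOWER, AT ONE HEIGHT — «V81» `Beta.RemainderOriginLeftEntry` INSTANTIATED ON
# THE TOWER CARRIERS WITH THE LEFT ENTRY `E = D*_U`: the (190) letter of `D*_U∘(H₀ + G̃Δ⁽²⁾H₀)` (coarse bonds → fine SITES) from `hG0`, `hInv₀` and ONE more
# letter `hEG0` = the divergence row of `G₁,k(U)` («Y6»)**

CITATION HEADER (lean-in-tree rule 2026-08-18).  Sources and loci as in «Y5b» `Beta.RemainderOriginTower` and «V81» `Beta.RemainderOriginLeftEntry`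
(this lineage, gen 111): [Balaban1985Variational] (B11 = [15]; held `paper:balaban1985-cmp102-variational-background`, journal page = PDF page + 276):
(129) p. 297, (131) p. 298, p. 306 after (179), (180) p. 306, (182) p. 307, (186)–(187) p. 308, (190) p. 308, (45) p. 285, (110) p. 294;
[Balaban1985BackgroundPropagators] (B9 = [5]; `paper:balaban1985-cmp99-background-propagators`, journal page = PDF page + 388): (3.8) p. 392 (the
covariant divergence), Thm 3.1 (3.42) p. 397, Thm 3.3 p. 399, (3.15)–(3.16) p. 393, (3.26) p. 395, Thm 3.11 p. 416, (3.126) p. 420, (3.132)–(3.133)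
p. 422, (3.137)–(3.138) p. 423; [Balaban1984PropagatorsII] (B6) (2.51)–(2.52) p. 232, (2.54) p. 233, Lemma 2.1 (2.61) p. 234.  [15] pp. 297, 306–308 and
[5] pp. 397–399, 420–423 re-read this generation in the held text layers; the other loci as printed in the headers of the tree files consumed.

WHY THIS FILE (audit cell `pub-balaban`, BINDER row (D4), OWNER lineage `b2b-balaban-beta-an4`, gen 111).  NODE D's `Data190.h190` runs over EVERY local size
of [I] (4.4), i.e. every LINE of (190).  «Y5b» is the VALUE line on NE9's tower; «V81» shows abstractly that each further line costs ONE letter, the same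
line of (3.42) for `G₀`.  THIS FILE is «Y5b» with the left entry `E := D*_U = B11Eq103H1Complex.covDivL2K ℂ c₀ (η⁻¹) (adTransportW φ (U⁻¹))` (fine
bonds → fine sites, conjugated by the `WL2.linearEquiv` identifications; target = the (190) sup size on the fine SITES blocked by `blockCoord (L^(n+1)) m
∘ siteCast`): the SAME binders as «Y5b» plus `hEG0 : HasMaj S^{fine bonds} S^{fine sites} ((e_S ∘ D*_U∘G₁,k ∘ e⁻¹)↾ℝ) (B_E·e^{−δ₀·d_∞})` — DISPLAYED at
this height in EXACTLY the shape «Y6» `Beta.RemainderHasMajDivG1kTower.exists_hasMaj_divG1k_tower_sup` delivers ∃-first from the NE9 crew's (DGK)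
`B9Eq326G1kDivergenceRowClosed.exists_divergence_row_G1k` — and the three constants `A₀ᴱ`, `B_{G′}ᴱ`, `B_G̃ᴱ` bound by `hA₀E`, `hBEG'`, `hBEt` (`rfl`).
* **`exists_ineq190_div_origin_tower_sup`** — conclusion = «Y5b»'s (`G′`, `(Q_kG′Q_k†)⁻¹` CONSTRUCTED, two-sided) with the (190) letter for the
  DIVERGENCE line: `∀ δ′, δ′∕8 ≤ ρ → Ineq190 S^{coarse}_m S^{fine sites}_m (D*_Uᵉ ∘ (H₀ + G̃Δ⁽²⁾H₀)) (A₀ᴱ + B_G̃ᴱθ_Dc) δ′`, `H₀ = (G₁,kQ_k†(Q_kG₁,kQ_k†)⁻¹)ᵉ↾ℝ`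
  — «V81» `ineq190_origin_leftEntry_of_two_letters` with `E :=` the conjugated `D*_U`, every structural letter BY NAME as in «Y5b» (including «Y5a» §2's
  invertibility relations and `H₁,k = G₀Q*Inv₀·1`), `hEG0` converted to the geometry's distance and to the composite `Eᵉ ∘ G₀ᵉ` (the inner
  identifications cancel definitionally).
NEXT (not here): the `∃`-first END of the divergence line («Y5c»'s pattern: `hG0` := «Y4d», `hEG0` := «Y6», `hInv₀` := «Y4a», common window and rate).

HONEST SCOPE.  [folklore] plumbing: «V81» applied to tree theorems BY NAME; NO estimate of [5] or [15] is proved here; `hG0`, `hEG0`, `hInv₀`, `hD2`, the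
row-sum constant and the two smallnesses are hypotheses of the printed SHAPE; the rate ladder and constants are the cell's; nothing identifies Bałaban's
step-`k` objects with tree terms beyond NE9's tower (NODE O FROZEN (0)).  Row (D4) class UNCHANGED (instance 0∕1; D4 DISCHARGE NO DATE); NOT B12 Thm 2, NOT
BetaPertH, NOT continuum, NOT Clay.  HONEST DEPENDENCY (cell line): continuum YM on T⁴ ⇐ BetaPertH ∧ nine spine estimates (0/9 proved); BetaPertH ⇐ (D1) ∧
(D4) ∧ CAP+tail; G-an2-4 gates asym, D1 and NE2/3/4.  NEW file importing «Y5a» `Beta.RemainderHasMajH1kTower` and «V81» `Beta.RemainderOriginLeftEntry`;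
nothing modified; 0 `def`; standard axioms; no `sorry`; `maxHeartbeats` 400000 on the one theorem (as «Y5b»: binder unification at the budget's edge).
Net new unproved facts: 0.
-/

noncomputable section

open scoped BigOperators InnerProductSpace ComplexConjugate

namespace Literature.MathematicalPhysics.QuantumFieldTheory.Balaban1983to89.Beta.RemainderOriginTowerDiv

open B11SectG B11SupSize190 B11Reparam190
open B4Sect5Torus (TSite tdist ccoord tdist_nonneg tdist_symm)
open B4Sect5Proof (latticeConst)
open B5TorusCover (UT)
open B9Thm34Ext (toB6)
open B9Thm37GlueTorus (torusGeom tdist1 htri_torusGeom torusSum_tdist1_le)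
open B9SectCLatticeCarrier (Bond bpos)
open B9Eq311L2Pairing (WL2)
open B9Eq319QprimeTorus (fineP blockCoord)
open B9Eq315QTower (towerP UlevOf)
open B9Eq315QTorus (perCfg cornerSite)
open B9Eq316TowerFlatIsOneStep (siteCast towerP_eq_fineP_pow)
open B7Prop1Explicit (U1 Wcx boxVec)
open B11Eq103H1Complex (SiteL2K BondL2K KinvLatticeK covDivL2K)
open B9Eq310HessianOperator (adTransportW)
open B9Eq326OperatorTower (laplaceAk QkW G1k)
open Beta.RemainderOriginBaseLetters (hasMaj_supSize_const_of_opNorm exists_newG_supSize)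
open Beta.RemainderOriginTwoLetters (exists_invQGQ_supSize)
open Beta.RemainderOriginLeftEntry (ineq190_origin_leftEntry_of_two_letters)
open Beta.RemainderHasMajQkTower (hasMaj_QkW_tower_sup kernelQ_nonneg kernelQ_loc kernelQ_rowSum kernelQ_colSum hasMaj_supSize_id)
open Beta.RemainderHasMajH1kTower (inverse_relations h1_conj_eq)
open Beta.RemainderHasMajQkAdjointTower (hasMaj_adjoint_QkW_tower_sup_diagonal)

/-! ### Torus bookkeeping (private) -/

section Aux

variable {d : ℕ} {m : Fin d → ℕ}

/-- `ofSite a = y ↔ a = toSite y`. [folklore] -/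
private theorem ofSite_eq_iff (a : TSite d m) (y : UT m) : UT.ofSite m a = y ↔ a = UT.toSite m y := by
  constructor
  · rintro rfl; rfl
  · rintro rfl; rfl

/-- The boxes of the coarse bond-position map are its fibres. [folklore] -/
private theorem mem_boxBond_iff (y : UT m) (c : Bond d m) :
    c ∈ (Finset.univ.filter fun c : Bond d m => bpos c = UT.toSite m y) ↔ UT.ofSite m (bpos c) = y := by
  rw [Finset.mem_filter, ofSite_eq_iff]
  simp

/-- The boxes of the fine-bond big-block map are its fibres. [folklore] -/
private theorem mem_boxFine_iff {L : ℕ} [NeZero L] {n : ℕ} (y : UT m) (b : Bond d (towerP L m (n + 1))) :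
    b ∈ (Finset.univ.filter fun b : Bond d (towerP L m (n + 1)) =>
        blockCoord (L ^ (n + 1)) m (siteCast (towerP_eq_fineP_pow L m (n + 1)) (bpos b)) = UT.toSite m y) ↔
      UT.ofSite m (blockCoord (L ^ (n + 1)) m (siteCast (towerP_eq_fineP_pow L m (n + 1)) (bpos b))) = y := by
  rw [Finset.mem_filter, ofSite_eq_iff]
  simp

/-- The boxes of the fine-site big-block map are its fibres. [folklore] -/
private theorem mem_boxSite_iff {L : ℕ} [NeZero L] {n : ℕ} (y : UT m) (x : TSite d (towerP L m (n + 1))) :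
    x ∈ (Finset.univ.filter fun x : TSite d (towerP L m (n + 1)) =>
        blockCoord (L ^ (n + 1)) m (siteCast (towerP_eq_fineP_pow L m (n + 1)) x) = UT.toSite m y) ↔
      UT.ofSite m (blockCoord (L ^ (n + 1)) m (siteCast (towerP_eq_fineP_pow L m (n + 1)) x)) = y := by
  rw [Finset.mem_filter, ofSite_eq_iff]
  simp

variable [∀ i, NeZero (m i)]

/-- `d₁ ≤ d·d_∞` on the torus of blocks. [folklore] -/
private theorem tdist1_le_mul_tdist (y v : UT m) :
    tdist1 m y v ≤ d * tdist m (UT.toSite m y) (UT.toSite m v) := by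
  unfold tdist1 tdist
  have h : ∀ i ∈ (Finset.univ : Finset (Fin d)),
      ((ccoord m (UT.toSite m y) (UT.toSite m v) i : ℕ) : ℝ) ≤
        ((Finset.univ.sup (ccoord m (UT.toSite m y) (UT.toSite m v)) : ℕ) : ℝ) :=
    fun i hi => by exact_mod_cast Finset.le_sup (f := ccoord m (UT.toSite m y) (UT.toSite m v)) hi
  calc ∑ i, ((ccoord m (UT.toSite m y) (UT.toSite m v) i : ℕ) : ℝ)
      ≤ ∑ _i : Fin d, ((Finset.univ.sup (ccoord m (UT.toSite m y) (UT.toSite m v)) : ℕ) : ℝ) :=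
        Finset.sum_le_sum h
    _ = d * ((Finset.univ.sup (ccoord m (UT.toSite m y) (UT.toSite m v)) : ℕ) : ℝ) := by
        rw [Finset.sum_const, Finset.card_univ, Fintype.card_fin, nsmul_eq_mul]

/-- `e^{−r·d_∞} ≤ e^{−(r/d)·d₁}` for `r ≥ 0`. [folklore] -/
private theorem exp_tdist_le_exp_tdist1 {r : ℝ} (hr : 0 ≤ r) (η₀ L₀ M₀ R : ℝ) (H : Prop) (y v : UT m) :
    Real.exp (-(r * tdist m (UT.toSite m y) (UT.toSite m v))) ≤
      Real.exp (-(r / d * (toB6 (torusGeom m η₀ L₀ M₀) R H).dist y v)) := by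
  refine Real.exp_le_exp.mpr (neg_le_neg ?_)
  show r / d * tdist1 m y v ≤ _
  have h1 := tdist1_le_mul_tdist y v
  have ht : 0 ≤ tdist m (UT.toSite m y) (UT.toSite m v) := tdist_nonneg _ _ _
  rcases Nat.eq_zero_or_pos d with hd | hd
  · subst hd
    simp only [Nat.cast_zero, div_zero, zero_mul]
    exact mul_nonneg hr ht
  · have hd' : (0 : ℝ) < d := by exact_mod_cast hd
    calc r / d * tdist1 m y v ≤ r / d * (d * tdist m (UT.toSite m y) (UT.toSite m v)) :=
          mul_le_mul_of_nonneg_left h1 (div_nonneg hr hd'.le)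
      _ = r * tdist m (UT.toSite m y) (UT.toSite m v) := by
          field_simp

end Aux

/-! ## The DIVERGENCE line of NODE D at the origin on NE9's tower, at ONE height: «V81» instantiated with `E = D*_U` -/

section OneHeight

variable {d : ℕ} (L : ℕ) [NeZero L] (m : Fin d → ℕ) [∀ i, NeZero (m i)] (n : ℕ)
  {𝔸 : Type*} [NormedRing 𝔸] [NormedAlgebra ℂ 𝔸] [CompleteSpace 𝔸] [NormOneClass 𝔸] [StarRing 𝔸] [StarModule ℂ 𝔸]
  {W : Type} [NormedAddCommGroup W] [InnerProductSpace ℂ W] [FiniteDimensional ℂ W] (φ : W ≃ₗ[ℂ] 𝔸) {c₀ c₁ : ℝ}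
  [Fact (0 < c₀)] [Fact (0 < c₁)] (η : ℝ)
  (U : Bond d (towerP L m (n + 1)) → 𝔸ˣ) (hL : 1 ≤ L) (α : ℕ → ℝ) (hα0 : ∀ j, 0 ≤ α j) (hα1 : ∀ j, α j ≤ 1 / 64)
  (hU1 : ∀ (j : ℕ) (x : B7Prop1Explicit.Site d) (κ : Fin d), perCfg (towerP L m (j + 1)) (UlevOf L m (n + 1) U j) x κ ∈ U1 𝔸)
  (hreg : ∀ (j : ℕ) (y : TSite d (towerP L m j)) (κ : Fin d) (r : Fin d → Fin L),
    ‖((Wcx L (perCfg (towerP L m (j + 1)) (UlevOf L m (n + 1) U j)) (cornerSite L y) κ (boxVec L r) : 𝔸ˣ) : 𝔸) - 1‖ ≤ α j)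
  {Mφ Mφ' : ℝ} (hMφ : 0 ≤ Mφ) (hφ : ∀ w, ‖φ w‖ ≤ Mφ * ‖w‖) (hMφ' : 0 ≤ Mφ') (hφ' : ∀ X, ‖φ.symm X‖ ≤ Mφ' * ‖X‖)
  (τ : 𝔸 →ₗ[ℂ] ℂ) {a : ℝ}
  (hpos : ∀ x : BondL2K ℂ d (towerP L m (n + 1)) c₀ W, x ≠ 0 →
    0 < RCLike.re ⟪x, laplaceAk L m n φ η U hL α hα1 hU1 hreg τ (c₀ := c₀) (c₁ := c₁) a x⟫_ℂ)
  (hQ : Function.Surjective (QkW L m n φ U hL α hα1 hU1 hreg (c₀ := c₀) (c₁ := c₁)))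
  (η₀ L₀ M₀ R : ℝ) (H : Prop)

set_option maxHeartbeats 400000 in
include hα0 hMφ hφ hMφ' hφ' in
/-- **THE DIVERGENCE LINE OF NODE D AT THE ORIGIN IN A BACKGROUND ON NE9's TOWER, AT ONE HEIGHT — «V81» INSTANTIATED WITH `E = D*_U`** ([15] (182),
(190); [5] (3.42), the `∇_U` line, and (3.8)).  Binders = «Y5b» `Beta.RemainderOriginTower.exists_ineq190_origin_tower_sup`'s, token for token, PLUS
`hBE : 0 ≤ B_E` and `hEG0` (the divergence row of `G₁,k(U)`: majorant `B_Ee^{−δ₀d_∞}` fine bonds → fine sites at the SAME rate `δ₀` as `hG0` — «Y6»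
supplies it ∃-first) and the three derived constants `A₀ᴱ = B_E·(M†eK_d(1))·e^{δ₀}·A′·c`, `B_{G′}ᴱ = B_E + B_Eλe^{(δ₀∕d)r_D}B_{G′}c`,
`B_G̃ᴱ = B_{G′}ᴱ + (MeK_d(1))(M†eK_d(1))B_I′B_{G′}ᴱB_{G′}e^{2(ρ+2σ)d}c²` (`hA₀E`, `hBEG'`, `hBEt`; instantiate with `rfl`).  CONCLUSION: there are
continuous linear `G′` (fine) and `Inv′` (coarse) with the four invertibility relations of «Y5b» and, for every `δ′` with `δ′∕8 ≤ ρ`,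
`Ineq190 S^{coarse}_m S^{fine sites}_m (D*_Uᵉ ∘ (H₀ + G̃Δ⁽²⁾H₀)) (A₀ᴱ + B_G̃ᴱθ_Dc) δ′`, `D*_Uᵉ = (e_S ∘ covDivL2K ℂ c₀ (η⁻¹) (adTransportW φ (U⁻¹)) ∘ e⁻¹)↾ℝ`,
`H₀ = (G₁,kQ_k†(Q_kG₁,kQ_k†)⁻¹)ᵉ↾ℝ`, `G̃ = G′ − G′Q_k†ᵉ·Inv′·Q_kᵉG′`.
[cite: Balaban1985Variational, (182) p.307, (190) p.308, (129)–(131) pp.297–298, p.306 after (179), (180) p.306, (186)–(187) p.308; Balaban1985BackgroundPropagators, Thm 3.1 (3.42) p.397, Thm 3.3 p.399, (3.8) p.392, (3.126) p.420, (3.132)–(3.133) p.422, (3.137)–(3.138) p.423, Thm 3.11 p.416; Balaban1984PropagatorsII, (2.54) p.233, Lemma 2.1 (2.61) p.234] -/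
theorem exists_ineq190_div_origin_tower_sup (hd : 1 ≤ d) (hm : ∀ i, 1 ≤ m i) (hw : c₀ * ((L : ℝ) ^ (n + 1)) ^ d = c₁) {A : ℝ}
    (hA : ∑ j ∈ Finset.range (n + 1), α j ≤ A)
    {B₀ δ₀ A' r₁ ρ σ c BE : ℝ} (hB₀ : 0 ≤ B₀) (hδ₀ : 0 ≤ δ₀) (hA' : 0 ≤ A') (hr₁ : 0 ≤ r₁) (hBE : 0 ≤ BE)
    (hrow : RowSum (toB6 (torusGeom m η₀ L₀ M₀) R H) σ c) (hc : 0 ≤ c) (hσ : 0 ≤ σ) (hρ : 0 ≤ ρ)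
    (hρ₁ : ρ + 5 * σ ≤ δ₀ / d) (hρI : ρ + 5 * σ ≤ r₁ / d)
    -- the ONE analytic letter: the height-free sup row of `G₁,k(U)` ([5] Thm 3.3 (3.42), first entry)
    (hG0 : HasMaj
      (supSize (toB6 (torusGeom m η₀ L₀ M₀) R H)
        (fun y => Finset.univ.filter fun b : Bond d (towerP L m (n + 1)) =>
          blockCoord (L ^ (n + 1)) m (siteCast (towerP_eq_fineP_pow L m (n + 1)) (bpos b)) = UT.toSite m y)
        (fun b => UT.ofSite m (blockCoord (L ^ (n + 1)) m (siteCast (towerP_eq_fineP_pow L m (n + 1)) (bpos b)))) :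
          BlockNorm (toB6 (torusGeom m η₀ L₀ M₀) R H) (Bond d (towerP L m (n + 1)) → W))
      (supSize (toB6 (torusGeom m η₀ L₀ M₀) R H)
        (fun y => Finset.univ.filter fun b : Bond d (towerP L m (n + 1)) =>
          blockCoord (L ^ (n + 1)) m (siteCast (towerP_eq_fineP_pow L m (n + 1)) (bpos b)) = UT.toSite m y)
        (fun b => UT.ofSite m (blockCoord (L ^ (n + 1)) m (siteCast (towerP_eq_fineP_pow L m (n + 1)) (bpos b)))))
      (((WL2.linearEquiv ℂ ℂ (fun _ : Bond d (towerP L m (n + 1)) => c₀) :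
            BondL2K ℂ d (towerP L m (n + 1)) c₀ W ≃ₗ[ℂ] (Bond d (towerP L m (n + 1)) → W)).toLinearMap ∘ₗ
          G1k L m n φ η U hL α hα1 hU1 hreg τ (c₀ := c₀) (c₁ := c₁) hpos ∘ₗ
          (WL2.linearEquiv ℂ ℂ (fun _ : Bond d (towerP L m (n + 1)) => c₀) :
            BondL2K ℂ d (towerP L m (n + 1)) c₀ W ≃ₗ[ℂ] (Bond d (towerP L m (n + 1)) → W)).symm.toLinearMap).restrictScalars ℝ)
      (fun y v => B₀ * Real.exp (-(δ₀ * tdist m (UT.toSite m y) (UT.toSite m v)))))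
    -- THE ONE NEW LETTER: the divergence row of `G₁,k(U)` (fine bonds → fine sites), at the same rate ((3.42), the `∇_U` line; «Y6»)
    (hEG0 : HasMaj
      (supSize (toB6 (torusGeom m η₀ L₀ M₀) R H)
        (fun y => Finset.univ.filter fun b : Bond d (towerP L m (n + 1)) =>
          blockCoord (L ^ (n + 1)) m (siteCast (towerP_eq_fineP_pow L m (n + 1)) (bpos b)) = UT.toSite m y)
        (fun b => UT.ofSite m (blockCoord (L ^ (n + 1)) m (siteCast (towerP_eq_fineP_pow L m (n + 1)) (bpos b)))) :
          BlockNorm (toB6 (torusGeom m η₀ L₀ M₀) R H) (Bond d (towerP L m (n + 1)) → W))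
      (supSize (toB6 (torusGeom m η₀ L₀ M₀) R H)
        (fun y => Finset.univ.filter fun x : TSite d (towerP L m (n + 1)) =>
          blockCoord (L ^ (n + 1)) m (siteCast (towerP_eq_fineP_pow L m (n + 1)) x) = UT.toSite m y)
        (fun x => UT.ofSite m (blockCoord (L ^ (n + 1)) m (siteCast (towerP_eq_fineP_pow L m (n + 1)) x))) :
          BlockNorm (toB6 (torusGeom m η₀ L₀ M₀) R H) (TSite d (towerP L m (n + 1)) → W))
      (((WL2.linearEquiv ℂ ℂ (fun _ : TSite d (towerP L m (n + 1)) => c₀) :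
            SiteL2K ℂ d (towerP L m (n + 1)) c₀ W ≃ₗ[ℂ] (TSite d (towerP L m (n + 1)) → W)).toLinearMap ∘ₗ
          (covDivL2K ℂ c₀ ((η : ℂ))⁻¹ (adTransportW φ fun bb => (U bb)⁻¹) ∘ₗ
            G1k L m n φ η U hL α hα1 hU1 hreg τ (c₀ := c₀) (c₁ := c₁) hpos) ∘ₗ
          (WL2.linearEquiv ℂ ℂ (fun _ : Bond d (towerP L m (n + 1)) => c₀) :
            BondL2K ℂ d (towerP L m (n + 1)) c₀ W ≃ₗ[ℂ] (Bond d (towerP L m (n + 1)) → W)).symm.toLinearMap).restrictScalars ℝ)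
      (fun y v => BE * Real.exp (-(δ₀ * tdist m (UT.toSite m y) (UT.toSite m v)))))
    -- the (3.132)-shape letter of `(Q_kG₁,kQ_k†)⁻¹` (a tree theorem: Y4a `exists_hasMaj_Kinv_tower_sup`)
    (hInv0 : HasMaj
      (supSize (toB6 (torusGeom m η₀ L₀ M₀) R H)
        (fun y => Finset.univ.filter fun c : Bond d m => bpos c = UT.toSite m y)
        (fun c => UT.ofSite m (bpos c)) : BlockNorm (toB6 (torusGeom m η₀ L₀ M₀) R H) (Bond d m → W))
      (supSize (toB6 (torusGeom m η₀ L₀ M₀) R H)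
        (fun y => Finset.univ.filter fun c : Bond d m => bpos c = UT.toSite m y)
        (fun c => UT.ofSite m (bpos c)))
      (((WL2.linearEquiv ℂ ℂ (fun _ : Bond d m => c₁) : BondL2K ℂ d m c₁ W ≃ₗ[ℂ] (Bond d m → W)).toLinearMap ∘ₗ
          KinvLatticeK hpos hQ ∘ₗ
          (WL2.linearEquiv ℂ ℂ (fun _ : Bond d m => c₁) : BondL2K ℂ d m c₁ W ≃ₗ[ℂ] (Bond d m → W)).symm.toLinearMap).restrictScalars ℝ)
      (fun y v => A' * Real.exp (-(r₁ * tdist m (UT.toSite m y) (UT.toSite m v)))))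
    -- `Δ⁽²⁾` DISPLAYED: a local operator on the fine carrier ((3.137): range `r_D`, row and column sums `≤ λ`)
    (D2 : BondL2K ℂ d (towerP L m (n + 1)) c₀ W →ₗ[ℂ] BondL2K ℂ d (towerP L m (n + 1)) c₀ W)
    {KD : UT m → UT m → ℝ} {lam rD : ℝ} (hlam : 0 ≤ lam) (hKD : ∀ y v, 0 ≤ KD y v)
    (hDloc : ∀ y v, KD y v ≠ 0 → (toB6 (torusGeom m η₀ L₀ M₀) R H).dist y v ≤ rD)
    (hDrow : ∀ y, ∑ v : UT m, KD y v ≤ lam) (hDcol : ∀ v, ∑ y : UT m, KD y v ≤ lam)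
    (hD2 : HasMaj
      (supSize (toB6 (torusGeom m η₀ L₀ M₀) R H)
        (fun y => Finset.univ.filter fun b : Bond d (towerP L m (n + 1)) =>
          blockCoord (L ^ (n + 1)) m (siteCast (towerP_eq_fineP_pow L m (n + 1)) (bpos b)) = UT.toSite m y)
        (fun b => UT.ofSite m (blockCoord (L ^ (n + 1)) m (siteCast (towerP_eq_fineP_pow L m (n + 1)) (bpos b)))) :
          BlockNorm (toB6 (torusGeom m η₀ L₀ M₀) R H) (Bond d (towerP L m (n + 1)) → W))
      (supSize (toB6 (torusGeom m η₀ L₀ M₀) R H)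
        (fun y => Finset.univ.filter fun b : Bond d (towerP L m (n + 1)) =>
          blockCoord (L ^ (n + 1)) m (siteCast (towerP_eq_fineP_pow L m (n + 1)) (bpos b)) = UT.toSite m y)
        (fun b => UT.ofSite m (blockCoord (L ^ (n + 1)) m (siteCast (towerP_eq_fineP_pow L m (n + 1)) (bpos b)))))
      (((WL2.linearEquiv ℂ ℂ (fun _ : Bond d (towerP L m (n + 1)) => c₀) :
            BondL2K ℂ d (towerP L m (n + 1)) c₀ W ≃ₗ[ℂ] (Bond d (towerP L m (n + 1)) → W)).toLinearMap ∘ₗ D2 ∘ₗ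
          (WL2.linearEquiv ℂ ℂ (fun _ : Bond d (towerP L m (n + 1)) => c₀) :
            BondL2K ℂ d (towerP L m (n + 1)) c₀ W ≃ₗ[ℂ] (Bond d (towerP L m (n + 1)) → W)).symm.toLinearMap).restrictScalars ℝ)
      KD)
    -- the derived constants, bound to their closed forms (instantiate with `rfl`), and the TWO smallnesses in `λ`
    {q BG' θP qI BI' A₀ θD A₀E BEG' BEt : ℝ}
    (hq_def : q = B₀ * lam * Real.exp (δ₀ / d * rD) * c) (hq : q < 1) (hBG' : BG' = B₀ * (1 - q)⁻¹)
    (hθP : θP = B₀ * lam * Real.exp (δ₀ / d * rD) * BG' * c *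
      ((Mφ' * Real.exp (100 * d * (d + 1) * (L : ℝ) ^ d * A) * Mφ * ((2 * d : ℕ) : ℝ)) * Real.exp 1 * latticeConst d 1) *
      Real.exp ((ρ + 4 * σ) * d) * ((Mφ' * Mφ * Real.exp (50 * (d + 1) * A)) * Real.exp 1 * latticeConst d 1) *
      Real.exp ((ρ + 4 * σ) * d))
    (hqI : qI = A' * θP * c * c) (hqI1 : qI < 1) (hBI' : BI' = A' * (1 - qI)⁻¹)
    (hA₀ : A₀ = B₀ * ((Mφ' * Real.exp (100 * d * (d + 1) * (L : ℝ) ^ d * A) * Mφ * ((2 * d : ℕ) : ℝ)) * Real.exp 1 *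
      latticeConst d 1) * Real.exp δ₀ * A' * c)
    (hθD : θD = A₀ * lam * Real.exp (ρ * rD))
    (hA₀E : A₀E = BE * ((Mφ' * Real.exp (100 * d * (d + 1) * (L : ℝ) ^ d * A) * Mφ * ((2 * d : ℕ) : ℝ)) * Real.exp 1 * latticeConst d 1) * Real.exp δ₀ * A' * c)
    (hBEG' : BEG' = BE + BE * lam * Real.exp (δ₀ / d * rD) * BG' * c)
    (hBEt : BEt = BEG' + ((Mφ' * Mφ * Real.exp (50 * (d + 1) * A)) * Real.exp 1 * latticeConst d 1) *
      ((Mφ' * Real.exp (100 * d * (d + 1) * (L : ℝ) ^ d * A) * Mφ * ((2 * d : ℕ) : ℝ)) * Real.exp 1 * latticeConst d 1) *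
      BI' * BEG' * BG' * Real.exp ((ρ + 2 * σ) * d) * Real.exp ((ρ + 2 * σ) * d) * c * c) :
    ∃ (G' : (Bond d (towerP L m (n + 1)) → W) →L[ℂ] (Bond d (towerP L m (n + 1)) → W))
      (Inv' : (Bond d m → W) →L[ℂ] (Bond d m → W)),
      -- `G′ = (Δ_{a,k}(U) − Δ⁽²⁾)⁻¹`, two-sided
      G' * (LinearMap.toContinuousLinearMap
          ((WL2.linearEquiv ℂ ℂ (fun _ : Bond d (towerP L m (n + 1)) => c₀) :
              BondL2K ℂ d (towerP L m (n + 1)) c₀ W ≃ₗ[ℂ] (Bond d (towerP L m (n + 1)) → W)).toLinearMap ∘ₗ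
            laplaceAk L m n φ η U hL α hα1 hU1 hreg τ (c₀ := c₀) (c₁ := c₁) a ∘ₗ
            (WL2.linearEquiv ℂ ℂ (fun _ : Bond d (towerP L m (n + 1)) => c₀) :
              BondL2K ℂ d (towerP L m (n + 1)) c₀ W ≃ₗ[ℂ] (Bond d (towerP L m (n + 1)) → W)).symm.toLinearMap) -
        LinearMap.toContinuousLinearMap
          ((WL2.linearEquiv ℂ ℂ (fun _ : Bond d (towerP L m (n + 1)) => c₀) :
              BondL2K ℂ d (towerP L m (n + 1)) c₀ W ≃ₗ[ℂ] (Bond d (towerP L m (n + 1)) → W)).toLinearMap ∘ₗ D2 ∘ₗ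
            (WL2.linearEquiv ℂ ℂ (fun _ : Bond d (towerP L m (n + 1)) => c₀) :
              BondL2K ℂ d (towerP L m (n + 1)) c₀ W ≃ₗ[ℂ] (Bond d (towerP L m (n + 1)) → W)).symm.toLinearMap)) = 1 ∧
      (LinearMap.toContinuousLinearMap
          ((WL2.linearEquiv ℂ ℂ (fun _ : Bond d (towerP L m (n + 1)) => c₀) :
              BondL2K ℂ d (towerP L m (n + 1)) c₀ W ≃ₗ[ℂ] (Bond d (towerP L m (n + 1)) → W)).toLinearMap ∘ₗ
            laplaceAk L m n φ η U hL α hα1 hU1 hreg τ (c₀ := c₀) (c₁ := c₁) a ∘ₗ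
            (WL2.linearEquiv ℂ ℂ (fun _ : Bond d (towerP L m (n + 1)) => c₀) :
              BondL2K ℂ d (towerP L m (n + 1)) c₀ W ≃ₗ[ℂ] (Bond d (towerP L m (n + 1)) → W)).symm.toLinearMap) -
        LinearMap.toContinuousLinearMap
          ((WL2.linearEquiv ℂ ℂ (fun _ : Bond d (towerP L m (n + 1)) => c₀) :
              BondL2K ℂ d (towerP L m (n + 1)) c₀ W ≃ₗ[ℂ] (Bond d (towerP L m (n + 1)) → W)).toLinearMap ∘ₗ D2 ∘ₗ
            (WL2.linearEquiv ℂ ℂ (fun _ : Bond d (towerP L m (n + 1)) => c₀) :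
              BondL2K ℂ d (towerP L m (n + 1)) c₀ W ≃ₗ[ℂ] (Bond d (towerP L m (n + 1)) → W)).symm.toLinearMap)) * G' = 1 ∧
      -- `Inv′ = (Q_kG′Q_k†)⁻¹`, two-sided
      Inv' * ((LinearMap.toContinuousLinearMap
          ((WL2.linearEquiv ℂ ℂ (fun _ : Bond d m => c₁) : BondL2K ℂ d m c₁ W ≃ₗ[ℂ] (Bond d m → W)).toLinearMap ∘ₗ
            QkW L m n φ U hL α hα1 hU1 hreg (c₀ := c₀) (c₁ := c₁) ∘ₗ
            (WL2.linearEquiv ℂ ℂ (fun _ : Bond d (towerP L m (n + 1)) => c₀) :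
              BondL2K ℂ d (towerP L m (n + 1)) c₀ W ≃ₗ[ℂ] (Bond d (towerP L m (n + 1)) → W)).symm.toLinearMap)).comp
        (G'.comp (LinearMap.toContinuousLinearMap
          ((WL2.linearEquiv ℂ ℂ (fun _ : Bond d (towerP L m (n + 1)) => c₀) :
              BondL2K ℂ d (towerP L m (n + 1)) c₀ W ≃ₗ[ℂ] (Bond d (towerP L m (n + 1)) → W)).toLinearMap ∘ₗ
            LinearMap.adjoint (QkW L m n φ U hL α hα1 hU1 hreg (c₀ := c₀) (c₁ := c₁)) ∘ₗ
            (WL2.linearEquiv ℂ ℂ (fun _ : Bond d m => c₁) : BondL2K ℂ d m c₁ W ≃ₗ[ℂ] (Bond d m → W)).symm.toLinearMap)))) = 1 ∧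
      ((LinearMap.toContinuousLinearMap
          ((WL2.linearEquiv ℂ ℂ (fun _ : Bond d m => c₁) : BondL2K ℂ d m c₁ W ≃ₗ[ℂ] (Bond d m → W)).toLinearMap ∘ₗ
            QkW L m n φ U hL α hα1 hU1 hreg (c₀ := c₀) (c₁ := c₁) ∘ₗ
            (WL2.linearEquiv ℂ ℂ (fun _ : Bond d (towerP L m (n + 1)) => c₀) :
              BondL2K ℂ d (towerP L m (n + 1)) c₀ W ≃ₗ[ℂ] (Bond d (towerP L m (n + 1)) → W)).symm.toLinearMap)).comp
        (G'.comp (LinearMap.toContinuousLinearMap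
          ((WL2.linearEquiv ℂ ℂ (fun _ : Bond d (towerP L m (n + 1)) => c₀) :
              BondL2K ℂ d (towerP L m (n + 1)) c₀ W ≃ₗ[ℂ] (Bond d (towerP L m (n + 1)) → W)).toLinearMap ∘ₗ
            LinearMap.adjoint (QkW L m n φ U hL α hα1 hU1 hreg (c₀ := c₀) (c₁ := c₁)) ∘ₗ
            (WL2.linearEquiv ℂ ℂ (fun _ : Bond d m => c₁) : BondL2K ℂ d m c₁ W ≃ₗ[ℂ] (Bond d m → W)).symm.toLinearMap)))) * Inv' = 1 ∧
      -- the (190) letter of `H₀ + G̃Δ⁽²⁾H₀`, `H₀ = H₁,k(U)` by name, `G̃ = G′ − G′Q_k†·Inv′·Q_kG′`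
      ∀ δ : ℝ, δ / 8 ≤ ρ →
        Ineq190
          (supSize (toB6 (torusGeom m η₀ L₀ M₀) R H)
            (fun y => Finset.univ.filter fun c : Bond d m => bpos c = UT.toSite m y)
            (fun c => UT.ofSite m (bpos c)) : BlockNorm (toB6 (torusGeom m η₀ L₀ M₀) R H) (Bond d m → W))
          (supSize (toB6 (torusGeom m η₀ L₀ M₀) R H)
            (fun y => Finset.univ.filter fun x : TSite d (towerP L m (n + 1)) =>
              blockCoord (L ^ (n + 1)) m (siteCast (towerP_eq_fineP_pow L m (n + 1)) x) = UT.toSite m y)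
            (fun x => UT.ofSite m (blockCoord (L ^ (n + 1)) m (siteCast (towerP_eq_fineP_pow L m (n + 1)) x))) :
              BlockNorm (toB6 (torusGeom m η₀ L₀ M₀) R H) (TSite d (towerP L m (n + 1)) → W))
          ((((WL2.linearEquiv ℂ ℂ (fun _ : TSite d (towerP L m (n + 1)) => c₀) :
                SiteL2K ℂ d (towerP L m (n + 1)) c₀ W ≃ₗ[ℂ] (TSite d (towerP L m (n + 1)) → W)).toLinearMap ∘ₗ
              covDivL2K ℂ c₀ ((η : ℂ))⁻¹ (adTransportW φ fun bb => (U bb)⁻¹) ∘ₗ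
              (WL2.linearEquiv ℂ ℂ (fun _ : Bond d (towerP L m (n + 1)) => c₀) :
                BondL2K ℂ d (towerP L m (n + 1)) c₀ W ≃ₗ[ℂ] (Bond d (towerP L m (n + 1)) → W)).symm.toLinearMap).restrictScalars ℝ) ∘ₗ
          ((((WL2.linearEquiv ℂ ℂ (fun _ : Bond d (towerP L m (n + 1)) => c₀) :
                  BondL2K ℂ d (towerP L m (n + 1)) c₀ W ≃ₗ[ℂ] (Bond d (towerP L m (n + 1)) → W)).toLinearMap ∘ₗ
              (G1k L m n φ η U hL α hα1 hU1 hreg τ (c₀ := c₀) (c₁ := c₁) hpos ∘ₗ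
                LinearMap.adjoint (QkW L m n φ U hL α hα1 hU1 hreg (c₀ := c₀) (c₁ := c₁)) ∘ₗ KinvLatticeK hpos hQ) ∘ₗ
              (WL2.linearEquiv ℂ ℂ (fun _ : Bond d m => c₁) : BondL2K ℂ d m c₁ W ≃ₗ[ℂ] (Bond d m → W)).symm.toLinearMap).restrictScalars ℝ) +
            ((G'.restrictScalars ℝ : (Bond d (towerP L m (n + 1)) → W) →ₗ[ℝ] (Bond d (towerP L m (n + 1)) → W)) -
              ((G'.restrictScalars ℝ : (Bond d (towerP L m (n + 1)) → W) →ₗ[ℝ] (Bond d (towerP L m (n + 1)) → W)) ∘ₗ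
                (((WL2.linearEquiv ℂ ℂ (fun _ : Bond d (towerP L m (n + 1)) => c₀) :
                      BondL2K ℂ d (towerP L m (n + 1)) c₀ W ≃ₗ[ℂ] (Bond d (towerP L m (n + 1)) → W)).toLinearMap ∘ₗ
                  LinearMap.adjoint (QkW L m n φ U hL α hα1 hU1 hreg (c₀ := c₀) (c₁ := c₁)) ∘ₗ
                  (WL2.linearEquiv ℂ ℂ (fun _ : Bond d m => c₁) : BondL2K ℂ d m c₁ W ≃ₗ[ℂ] (Bond d m → W)).symm.toLinearMap).restrictScalars ℝ)) ∘ₗ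
              (Inv'.restrictScalars ℝ : (Bond d m → W) →ₗ[ℝ] (Bond d m → W)) ∘ₗ
              ((((WL2.linearEquiv ℂ ℂ (fun _ : Bond d m => c₁) : BondL2K ℂ d m c₁ W ≃ₗ[ℂ] (Bond d m → W)).toLinearMap ∘ₗ
                  QkW L m n φ U hL α hα1 hU1 hreg (c₀ := c₀) (c₁ := c₁) ∘ₗ
                  (WL2.linearEquiv ℂ ℂ (fun _ : Bond d (towerP L m (n + 1)) => c₀) :
                    BondL2K ℂ d (towerP L m (n + 1)) c₀ W ≃ₗ[ℂ] (Bond d (towerP L m (n + 1)) → W)).symm.toLinearMap).restrictScalars ℝ) ∘ₗ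
                (G'.restrictScalars ℝ : (Bond d (towerP L m (n + 1)) → W) →ₗ[ℝ] (Bond d (towerP L m (n + 1)) → W)))) ∘ₗ
            ((((WL2.linearEquiv ℂ ℂ (fun _ : Bond d (towerP L m (n + 1)) => c₀) :
                    BondL2K ℂ d (towerP L m (n + 1)) c₀ W ≃ₗ[ℂ] (Bond d (towerP L m (n + 1)) → W)).toLinearMap ∘ₗ D2 ∘ₗ
                (WL2.linearEquiv ℂ ℂ (fun _ : Bond d (towerP L m (n + 1)) => c₀) :
                  BondL2K ℂ d (towerP L m (n + 1)) c₀ W ≃ₗ[ℂ] (Bond d (towerP L m (n + 1)) → W)).symm.toLinearMap).restrictScalars ℝ) ∘ₗ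
              (((WL2.linearEquiv ℂ ℂ (fun _ : Bond d (towerP L m (n + 1)) => c₀) :
                    BondL2K ℂ d (towerP L m (n + 1)) c₀ W ≃ₗ[ℂ] (Bond d (towerP L m (n + 1)) → W)).toLinearMap ∘ₗ
                (G1k L m n φ η U hL α hα1 hU1 hreg τ (c₀ := c₀) (c₁ := c₁) hpos ∘ₗ
                  LinearMap.adjoint (QkW L m n φ U hL α hα1 hU1 hreg (c₀ := c₀) (c₁ := c₁)) ∘ₗ KinvLatticeK hpos hQ) ∘ₗ
                (WL2.linearEquiv ℂ ℂ (fun _ : Bond d m => c₁) : BondL2K ℂ d m c₁ W ≃ₗ[ℂ] (Bond d m → W)).symm.toLinearMap).restrictScalars ℝ))))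
          (A₀E + BEt * θD * c) δ := by
  have hd0 : (d : ℝ) ≠ 0 := Nat.cast_ne_zero.mpr (by omega)
  have htri := htri_torusGeom (N := m) η₀ L₀ M₀ R H
  have hdist : ∀ y v : (toB6 (torusGeom m η₀ L₀ M₀) R H).Site, 0 ≤ (toB6 (torusGeom m η₀ L₀ M₀) R H).dist y v :=
    fun y v => B9Thm37GlueTorus.tdist1_nonneg y v
  letI : DecidableEq (toB6 (torusGeom m η₀ L₀ M₀) R H).Site := inferInstanceAs (DecidableEq (UT m))
  -- names for the geometry, the carriers' identifications and the two sup sizes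
  set gT := toB6 (torusGeom m η₀ L₀ M₀) R H with hgT
  set eF := (WL2.linearEquiv ℂ ℂ (fun _ : Bond d (towerP L m (n + 1)) => c₀) :
    BondL2K ℂ d (towerP L m (n + 1)) c₀ W ≃ₗ[ℂ] (Bond d (towerP L m (n + 1)) → W)) with heF
  set eC := (WL2.linearEquiv ℂ ℂ (fun _ : Bond d m => c₁) : BondL2K ℂ d m c₁ W ≃ₗ[ℂ] (Bond d m → W)) with heC
  set SF : BlockNorm gT (Bond d (towerP L m (n + 1)) → W) := supSize gT
    (fun y => Finset.univ.filter fun b : Bond d (towerP L m (n + 1)) =>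
      blockCoord (L ^ (n + 1)) m (siteCast (towerP_eq_fineP_pow L m (n + 1)) (bpos b)) = UT.toSite m y)
    (fun b => UT.ofSite m (blockCoord (L ^ (n + 1)) m (siteCast (towerP_eq_fineP_pow L m (n + 1)) (bpos b)))) with hSF
  set SC : BlockNorm gT (Bond d m → W) := supSize gT (fun y => Finset.univ.filter fun c : Bond d m => bpos c = UT.toSite m y)
    (fun c => UT.ofSite m (bpos c)) with hSC
  have hboxF : ∀ (y : gT.Site) (b : Bond d (towerP L m (n + 1))),
      b ∈ (Finset.univ.filter fun b : Bond d (towerP L m (n + 1)) =>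
        blockCoord (L ^ (n + 1)) m (siteCast (towerP_eq_fineP_pow L m (n + 1)) (bpos b)) = UT.toSite m y) ↔
      UT.ofSite m (blockCoord (L ^ (n + 1)) m (siteCast (towerP_eq_fineP_pow L m (n + 1)) (bpos b))) = y :=
    fun y b => mem_boxFine_iff y b
  have hboxS : ∀ (y : gT.Site) (x : TSite d (towerP L m (n + 1))),
      x ∈ (Finset.univ.filter fun x : TSite d (towerP L m (n + 1)) =>
        blockCoord (L ^ (n + 1)) m (siteCast (towerP_eq_fineP_pow L m (n + 1)) x) = UT.toSite m y) ↔
      UT.ofSite m (blockCoord (L ^ (n + 1)) m (siteCast (towerP_eq_fineP_pow L m (n + 1)) x)) = y :=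
    fun y x => mem_boxSite_iff y x
  have hboxC : ∀ (y : gT.Site) (c : Bond d m),
      c ∈ (Finset.univ.filter fun c : Bond d m => bpos c = UT.toSite m y) ↔ UT.ofSite m (bpos c) = y :=
    fun y c => mem_boxBond_iff y c
  -- the operators as continuous linear maps on the function carriers (finite dimension)
  let G0c : (Bond d (towerP L m (n + 1)) → W) →L[ℂ] (Bond d (towerP L m (n + 1)) → W) :=
    LinearMap.toContinuousLinearMap (eF.toLinearMap ∘ₗ G1k L m n φ η U hL α hα1 hU1 hreg τ (c₀ := c₀) (c₁ := c₁) hpos ∘ₗ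
      eF.symm.toLinearMap)
  let Dac : (Bond d (towerP L m (n + 1)) → W) →L[ℂ] (Bond d (towerP L m (n + 1)) → W) :=
    LinearMap.toContinuousLinearMap (eF.toLinearMap ∘ₗ laplaceAk L m n φ η U hL α hα1 hU1 hreg τ (c₀ := c₀) (c₁ := c₁) a ∘ₗ
      eF.symm.toLinearMap)
  let D2c : (Bond d (towerP L m (n + 1)) → W) →L[ℂ] (Bond d (towerP L m (n + 1)) → W) :=
    LinearMap.toContinuousLinearMap (eF.toLinearMap ∘ₗ D2 ∘ₗ eF.symm.toLinearMap)
  let Qc : (Bond d (towerP L m (n + 1)) → W) →L[ℂ] (Bond d m → W) :=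
    LinearMap.toContinuousLinearMap (eC.toLinearMap ∘ₗ QkW L m n φ U hL α hα1 hU1 hreg (c₀ := c₀) (c₁ := c₁) ∘ₗ
      eF.symm.toLinearMap)
  let Qsc : (Bond d m → W) →L[ℂ] (Bond d (towerP L m (n + 1)) → W) :=
    LinearMap.toContinuousLinearMap (eF.toLinearMap ∘ₗ LinearMap.adjoint (QkW L m n φ U hL α hα1 hU1 hreg (c₀ := c₀) (c₁ := c₁)) ∘ₗ
      eC.symm.toLinearMap)
  let Inv0c : (Bond d m → W) →L[ℂ] (Bond d m → W) :=
    LinearMap.toContinuousLinearMap (eC.toLinearMap ∘ₗ KinvLatticeK hpos hQ ∘ₗ eC.symm.toLinearMap)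
  -- the invertibility relations, automatic on finite carriers
  obtain ⟨hGD, hDG, hleft, hright⟩ := inverse_relations L m n φ η U hL α hα1 hU1 hreg τ hpos hQ
  -- the letters read in the geometry's distance (linear-map form for V79 §1, continuous-linear form for the existence statements)
  have hG0R := hG0.mono fun y v => mul_le_mul_of_nonneg_left (exp_tdist_le_exp_tdist1 hδ₀ η₀ L₀ M₀ R H y v) hB₀
  have hEG0R' := hEG0.mono fun y v => mul_le_mul_of_nonneg_left (exp_tdist_le_exp_tdist1 hδ₀ η₀ L₀ M₀ R H y v) hBE
  have hInv0R := hInv0.mono fun y v => mul_le_mul_of_nonneg_left (exp_tdist_le_exp_tdist1 hr₁ η₀ L₀ M₀ R H y v) hA'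
  have hG0' : HasMaj SF SF (G0c.restrictScalars ℝ : (Bond d (towerP L m (n + 1)) → W) →ₗ[ℝ] (Bond d (towerP L m (n + 1)) → W))
      (fun y v => B₀ * Real.exp (-(δ₀ / d * gT.dist y v))) :=
    hG0R.congr fun μ => rfl
  have hInv0' : HasMaj SC SC (Inv0c.restrictScalars ℝ : (Bond d m → W) →ₗ[ℝ] (Bond d m → W))
      (fun y v => A' * Real.exp (-(r₁ / d * gT.dist y v))) :=
    hInv0R.congr fun μ => rfl
  have hD2' : HasMaj SF SF (D2c.restrictScalars ℝ : (Bond d (towerP L m (n + 1)) → W) →ₗ[ℝ] (Bond d (towerP L m (n + 1)) → W)) KD :=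
    hD2.congr fun μ => rfl
  have hM : 0 ≤ Mφ' * Mφ * Real.exp (50 * (d + 1) * A) := by positivity
  have hMs : 0 ≤ Mφ' * Real.exp (100 * d * (d + 1) * (L : ℝ) ^ d * A) * Mφ * ((2 * d : ℕ) : ℝ) := by positivity
  have hνQ : 0 ≤ (Mφ' * Mφ * Real.exp (50 * (d + 1) * A)) * Real.exp 1 * latticeConst d 1 :=
    mul_nonneg (mul_nonneg hM (Real.exp_nonneg 1)) (B4Sect5Proof.latticeConst_nonneg d zero_le_one)
  have hνs : 0 ≤ (Mφ' * Real.exp (100 * d * (d + 1) * (L : ℝ) ^ d * A) * Mφ * ((2 * d : ℕ) : ℝ)) * Real.exp 1 * latticeConst d 1 :=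
    mul_nonneg (mul_nonneg hMs (Real.exp_nonneg 1)) (B4Sect5Proof.latticeConst_nonneg d zero_le_one)
  have hQR := hasMaj_QkW_tower_sup L m n φ U hL α hα1 hU1 hreg hφ hφ' hMφ hMφ' η₀ L₀ M₀ R H (c₀ := c₀) (c₁ := c₁) hm hα0 hA
  have hQsR := hasMaj_adjoint_QkW_tower_sup_diagonal L m n φ U hL α hα0 hα1 hU1 hreg hMφ hφ hMφ' hφ' η₀ L₀ M₀ R H
    (c₀ := c₀) (c₁ := c₁) hm hw hA
  have hQ' : HasMaj SF SC (Qc.restrictScalars ℝ : (Bond d (towerP L m (n + 1)) → W) →ₗ[ℝ] (Bond d m → W))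
      (fun y v => if tdist m (UT.toSite m y) (UT.toSite m v) ≤ 1 then Mφ' * Mφ * Real.exp (50 * (d + 1) * A) else 0) :=
    hQR.congr fun μ => rfl
  have hQs' : HasMaj SC SF (Qsc.restrictScalars ℝ : (Bond d m → W) →ₗ[ℝ] (Bond d (towerP L m (n + 1)) → W))
      (fun y u => if tdist m (UT.toSite m y) (UT.toSite m u) ≤ 1 then
        Mφ' * Real.exp (100 * d * (d + 1) * (L : ℝ) ^ d * A) * Mφ * ((2 * d : ℕ) : ℝ) else 0) :=
    hQsR.congr fun μ => rfl
  have hJ := hasMaj_supSize_id (g := gT) (E := W)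
    (box := fun y => Finset.univ.filter fun c : Bond d m => bpos c = UT.toSite m y)
    (blk := fun c => UT.ofSite m (bpos c)) hboxC
  -- the new G′ (V77 `exists_newG_supSize`), read at the rate ρ + 4σ
  have hq' : B₀ * lam * Real.exp (δ₀ / d * rD) * c < 1 := by rw [← hq_def]; exact hq
  obtain ⟨G', hG'l, hG'r, hfixG, -, hG'maj⟩ := exists_newG_supSize hboxF Dac G0c D2c hGD hDG htri hdist hrow hc hB₀ hlam hσ
    (by linarith) hKD hDloc hDcol hG0' hD2' hq'
  have hq0 : 0 ≤ q := by rw [hq_def]; positivity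
  have hBG'0 : 0 ≤ BG' := by rw [hBG']; exact mul_nonneg hB₀ (inv_nonneg.mpr (by linarith))
  have hG' : HasMaj SF SF (G'.restrictScalars ℝ : (Bond d (towerP L m (n + 1)) → W) →ₗ[ℝ] (Bond d (towerP L m (n + 1)) → W))
      (fun y v => BG' * Real.exp (-((ρ + 4 * σ) * gT.dist y v))) := by
    rw [hBG', hq_def]
    exact hG'maj (ρ + 4 * σ) (by positivity) (by linarith)
  -- the new (Q_kG′Q_k†)⁻¹ (V79 §2 `exists_invQGQ_supSize`)
  obtain ⟨Inv', hI'l, hI'r, hfixI, -, -⟩ := exists_invQGQ_supSize hboxC G0c G' D2c Qc Qsc Inv0c hleft hright hfixG htri hdist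
    hrow hc hB₀ hBG'0 hA' hlam hνQ hνs hσ (by linarith : σ ≤ ρ + 4 * σ) le_rfl (by linarith) (by linarith) hKD hDloc hDcol hD2'
    hG0' hG' (fun y v => kernelQ_nonneg m hM y v) (fun y v h => kernelQ_loc m η₀ L₀ M₀ R H y v h) (kernelQ_rowSum m hM hm) hQ'
    (fun y v => kernelQ_nonneg m hMs y v) (fun y v h => kernelQ_loc m η₀ L₀ M₀ R H y v h) (kernelQ_colSum m hMs hm) hQs' hInv0'
    hθP hqI hqI1
  refine ⟨G', Inv', hG'l, hG'r, hI'l, hI'r, fun δ hδ => ?_⟩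
  -- the resolvent identities over ℝ (linear-map form) and the automatic a priori bounds
  have hfix : (G'.restrictScalars ℝ : (Bond d (towerP L m (n + 1)) → W) →ₗ[ℝ] (Bond d (towerP L m (n + 1)) → W)) =
      ((eF.toLinearMap ∘ₗ G1k L m n φ η U hL α hα1 hU1 hreg τ (c₀ := c₀) (c₁ := c₁) hpos ∘ₗ eF.symm.toLinearMap).restrictScalars ℝ) +
        (((eF.toLinearMap ∘ₗ G1k L m n φ η U hL α hα1 hU1 hreg τ (c₀ := c₀) (c₁ := c₁) hpos ∘ₗ eF.symm.toLinearMap).restrictScalars ℝ) ∘ₗ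
          ((eF.toLinearMap ∘ₗ D2 ∘ₗ eF.symm.toLinearMap).restrictScalars ℝ)) ∘ₗ
          (G'.restrictScalars ℝ : (Bond d (towerP L m (n + 1)) → W) →ₗ[ℝ] (Bond d (towerP L m (n + 1)) → W)) := by
    apply LinearMap.ext
    intro f
    have e := congrArg (fun T : (Bond d (towerP L m (n + 1)) → W) →L[ℂ] (Bond d (towerP L m (n + 1)) → W) => T f) hfixG
    simp only [G0c, D2c, LinearMap.coe_toContinuousLinearMap', add_apply, mul_apply_eq_comp,
      LinearMap.add_apply, LinearMap.coe_comp, Function.comp_apply, LinearMap.coe_restrictScalars, ContinuousLinearMap.coe_coe,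
      ContinuousLinearMap.coe_restrictScalars', LinearEquiv.coe_coe] at e ⊢
    exact e
  have hfixI' : (Inv'.restrictScalars ℝ : (Bond d m → W) →ₗ[ℝ] (Bond d m → W)) =
      ((eC.toLinearMap ∘ₗ KinvLatticeK hpos hQ ∘ₗ eC.symm.toLinearMap).restrictScalars ℝ) -
        (((eC.toLinearMap ∘ₗ KinvLatticeK hpos hQ ∘ₗ eC.symm.toLinearMap).restrictScalars ℝ) ∘ₗ
          (((eC.toLinearMap ∘ₗ QkW L m n φ U hL α hα1 hU1 hreg (c₀ := c₀) (c₁ := c₁) ∘ₗ eF.symm.toLinearMap).restrictScalars ℝ) ∘ₗ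
            (((((eF.toLinearMap ∘ₗ G1k L m n φ η U hL α hα1 hU1 hreg τ (c₀ := c₀) (c₁ := c₁) hpos ∘ₗ
                    eF.symm.toLinearMap).restrictScalars ℝ) ∘ₗ
                ((eF.toLinearMap ∘ₗ D2 ∘ₗ eF.symm.toLinearMap).restrictScalars ℝ)) ∘ₗ
                (G'.restrictScalars ℝ : (Bond d (towerP L m (n + 1)) → W) →ₗ[ℝ] (Bond d (towerP L m (n + 1)) → W))) ∘ₗ
              ((eF.toLinearMap ∘ₗ LinearMap.adjoint (QkW L m n φ U hL α hα1 hU1 hreg (c₀ := c₀) (c₁ := c₁)) ∘ₗ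
                eC.symm.toLinearMap).restrictScalars ℝ)))) ∘ₗ
        (Inv'.restrictScalars ℝ : (Bond d m → W) →ₗ[ℝ] (Bond d m → W)) := by
    apply LinearMap.ext
    intro v
    have e := congrArg (fun T : (Bond d m → W) →L[ℂ] (Bond d m → W) => T v) hfixI
    simp only [G0c, D2c, Qc, Qsc, Inv0c, LinearMap.coe_toContinuousLinearMap', sub_apply, mul_apply_eq_comp,
      ContinuousLinearMap.comp_apply, LinearMap.sub_apply, LinearMap.coe_comp, Function.comp_apply, LinearMap.coe_restrictScalars,
      ContinuousLinearMap.coe_coe, ContinuousLinearMap.coe_restrictScalars', LinearEquiv.coe_coe] at e ⊢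
    exact e
  have hap := hasMaj_supSize_const_of_opNorm (g := gT) hboxF G'
  have hapI := hasMaj_supSize_const_of_opNorm (g := gT) hboxC Inv'
  -- `H₀ = G₀Q*·Inv₀·J` with `J = 1`
  have hH0def := h1_conj_eq L m n φ η U hL α hα1 hU1 hreg τ hpos hQ
  -- the left entry E = D*_U read as an ℝ-linear map between the sup sizes, and its letter against G₀
  set SS : BlockNorm gT (TSite d (towerP L m (n + 1)) → W) := supSize gT
    (fun y => Finset.univ.filter fun x : TSite d (towerP L m (n + 1)) =>
      blockCoord (L ^ (n + 1)) m (siteCast (towerP_eq_fineP_pow L m (n + 1)) x) = UT.toSite m y)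
    (fun x => UT.ofSite m (blockCoord (L ^ (n + 1)) m (siteCast (towerP_eq_fineP_pow L m (n + 1)) x))) with hSS
  have hEG0R : HasMaj SF SS
      ((((WL2.linearEquiv ℂ ℂ (fun _ : TSite d (towerP L m (n + 1)) => c₀) :
            SiteL2K ℂ d (towerP L m (n + 1)) c₀ W ≃ₗ[ℂ] (TSite d (towerP L m (n + 1)) → W)).toLinearMap ∘ₗ
          covDivL2K ℂ c₀ ((η : ℂ))⁻¹ (adTransportW φ fun bb => (U bb)⁻¹) ∘ₗ eF.symm.toLinearMap).restrictScalars ℝ) ∘ₗ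
        ((eF.toLinearMap ∘ₗ G1k L m n φ η U hL α hα1 hU1 hreg τ (c₀ := c₀) (c₁ := c₁) hpos ∘ₗ eF.symm.toLinearMap).restrictScalars ℝ))
      (fun y v => BE * Real.exp (-(δ₀ / d * gT.dist y v))) :=
    hEG0R'.congr fun μ => rfl
  -- «V81»
  have h := ineq190_origin_leftEntry_of_two_letters (bB := SC) (bN := SF) (b3 := SF) (bQ := SC) (bQ' := SC) (bE := SS)
    (J := LinearMap.id) (δ := δ)
    (((WL2.linearEquiv ℂ ℂ (fun _ : TSite d (towerP L m (n + 1)) => c₀) :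
          SiteL2K ℂ d (towerP L m (n + 1)) c₀ W ≃ₗ[ℂ] (TSite d (towerP L m (n + 1)) → W)).toLinearMap ∘ₗ
        covDivL2K ℂ c₀ ((η : ℂ))⁻¹ (adTransportW φ fun bb => (U bb)⁻¹) ∘ₗ eF.symm.toLinearMap).restrictScalars ℝ)
    (rJ := 0) (νJ := 1)
    htri hdist hrow hc hσ hρ hρ₁ hρI hδ hB₀ hA' (norm_nonneg G') (norm_nonneg Inv') hlam hνQ hνs zero_le_one hBE hG0R hEG0R hInv0R
    hH0def
    (fun y v => by split_ifs <;> norm_num)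
    (fun y v h => by
      by_cases hyv : y = v
      · subst hyv; exact le_of_eq (B9Thm37GlueTorus.tdist1_self y)
      · exact absurd (if_neg hyv) h)
    (fun v => by rw [Finset.sum_ite_eq' Finset.univ v]; simp) hJ
    hKD hDloc hDrow hDcol hD2 hfix hap (q := q) (by simp only [hSF, supSize_κ, one_mul]; exact hq_def) hq hBG'
    (fun y v => kernelQ_nonneg m hM y v) (fun y v h => kernelQ_loc m η₀ L₀ M₀ R H y v h) (kernelQ_rowSum m hM hm) hQR
    (fun y v => kernelQ_nonneg m hMs y v) (fun y v h => kernelQ_loc m η₀ L₀ M₀ R H y v h) (kernelQ_colSum m hMs hm) hQsR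
    hfixI' hapI (θP := θP) (by simp only [hSF, supSize_κ, one_mul]; exact hθP) (qI := qI)
    (by simp only [hSC, supSize_κ, one_mul]; exact hqI) hqI1 hBI' rfl
    (A₀ := A₀) (by simp only [hSF, hSC, supSize_κ, one_mul, mul_one, mul_zero, Real.exp_zero, div_mul_cancel₀ _ hd0]; exact hA₀)
    (θD := θD) (by simp only [hSF, supSize_κ, one_mul]; exact hθD)
    (A₀E := A₀E) (by simp only [hSF, hSC, supSize_κ, one_mul, mul_one, mul_zero, Real.exp_zero, div_mul_cancel₀ _ hd0]; exact hA₀E)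
    (BEG' := BEG') (by simp only [hSF, supSize_κ, one_mul]; exact hBEG')
    (BEt := BEt) (by simp only [hSF, hSC, supSize_κ, one_mul]; exact hBEt)
  have hκ : SF.κ = 1 := rfl
  rw [hκ, one_mul] at h
  exact h

end OneHeight

end Literature.MathematicalPhysics.QuantumFieldTheory.Balaban1983to89.Beta.RemainderOriginTowerDiv

end
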